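import Summits.Parity.GeneralizedHardyLittlewood.Theses.LiouvilleShiftedTables
import Summits.Parity.GeneralizedHardyLittlewood.Theorems.TableChowla.Negative.TableChowlaDegenerateWindows

/-!
# `TableChowla` (stmt-Parity-14270) FAILS for the pretenders `f ≡ 1` and `χ₄`

Negative lemmas for the crux `LiouvilleShiftedTables.TableChowla` (cdisprove seat). With
`TableChowlaFor f` the crux shape for a general `f : ℕ → ℝ` (`TableChowla ↔ TableChowlaFor λ`):
* `not_tableChowlaFor_one`: the ghost `f ≡ 1` (the multiplicative part of Selberg's `1 + λ`) has a
  rank-one table at every shift;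
* `not_tableChowlaFor_chi4`: the non-principal character `χ₄` — completely multiplicative, `±1` on
  odd integers, mean zero, equidistributed in every progression of odd modulus — has a RANK-ONE
  table at the shift `c = 4` (`chi4_mul_add_four : χ₄(ab+4) = χ₄(a)χ₄(b)`), so its fourth moment is
  `x²/16` against the claimed `x²/(log x)^C`.
Moral: a proof of the crux must use, quantitatively, that `λ` does not pretend to be a real
character of conductor dividing the shift (the Landau–Siegel ghost of the route text), not merely
`|λ| ≤ 1` and complete multiplicativity. [folklore]
-/

namespace Summit.Parity.GeneralizedHardyLittlewood.Theorems.TableChowla.Negative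

open Finset Real ArithmeticFunction
open Summit.Parity.GeneralizedHardyLittlewood.Theses

noncomputable section

/-- GHOST `f ≡ 1` (the multiplicative part of Selberg's `1 + λ`): rank one at every shift. -/
theorem not_tableChowlaFor_one : ¬ TableChowlaFor (fun _ => 1) := by
  intro h
  obtain ⟨x₀, hx₀⟩ := h 1 one_ne_zero (1 / 12) (by norm_num) le_rfl 1 one_pos
  obtain ⟨m, hm⟩ := exists_nat_ge (max x₀ 2)
  have hm2 : (2 : ℝ) ≤ m := le_trans (le_max_right _ _) hm
  have hmx : x₀ ≤ m := le_trans (le_max_left _ _) hm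
  have hm1 : (1 : ℝ) ≤ m := by linarith
  have hm1' : 1 ≤ m := by exact_mod_cast hm1
  have hm0 : m ≠ 0 := by omega
  have hxx₀ : x₀ ≤ (m : ℝ) ^ 12 := hmx.trans (le_self_pow₀ hm1 (by norm_num))
  obtain ⟨hw1, hw2⟩ := window_pow (k := 12) (by norm_num) hm1'
  have key := hx₀ ((m : ℝ) ^ 12) hxx₀ m (by exact_mod_cast hw1) (by exact_mod_cast hw2)
  rw [moment_pow _ 1 (by norm_num) hm0,
    momentN_of_rankOne (f := fun _ => (1 : ℝ)) (c := 1) (fun _ => 1) (fun _ => 1) (fun _ _ _ _ => by simp),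
    Real.rpow_one, Real.log_pow] at key
  simp only [one_pow, sum_const, Nat.card_Ioc, Nat.card_Icc, nsmul_eq_mul, mul_one,
    Nat.add_sub_cancel] at key
  rw [show 2 * m - m = m by omega, show (12 - 1 : ℕ) = 11 by norm_num] at key
  push_cast at key
  have hP : (0 : ℝ) < (m : ℝ) ^ 2 * ((m : ℝ) ^ 11) ^ 2 := by positivity
  refine absurd_of_le_div hP (κ := 1) ?_ zero_le_one ?_ key
  · exact le_of_eq (by ring)
  have := Real.log_le_log (by norm_num) hm2
  have := log_two_gt_half
  linarith

/-- The non-principal Dirichlet character mod 4 (extended by 0), as a real function. -/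
def chi4 (n : ℕ) : ℝ := if n % 4 = 1 then 1 else if n % 4 = 3 then -1 else 0

/-- `χ₄² = 𝟙_odd`. -/
theorem chi4_sq (n : ℕ) : chi4 n ^ 2 = if n % 2 = 1 then 1 else 0 := by
  have h4 : n % 4 < 4 := Nat.mod_lt n (by norm_num)
  have h2 : n % 2 = n % 4 % 2 := by omega
  unfold chi4
  rw [h2]
  interval_cases (n % 4) <;> norm_num

/-- `χ₄(ab + 4) = χ₄(a) χ₄(b)`: at the shift `c = 4` the χ₄-table is RANK ONE. -/
theorem chi4_mul_add_four (a b : ℕ) : chi4 (a * b + 4) = chi4 a * chi4 b := by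
  have ha : a % 4 < 4 := Nat.mod_lt a (by norm_num)
  have hb : b % 4 < 4 := Nat.mod_lt b (by norm_num)
  have hab : (a * b + 4) % 4 = (a % 4) * (b % 4) % 4 := by
    rw [Nat.add_mod_right, Nat.mul_mod]
  unfold chi4
  rw [hab]
  interval_cases (a % 4) <;> interval_cases (b % 4) <;> norm_num

/-- `[1, 2n]` contains `n` odd numbers. -/
theorem sum_chi4_sq_Icc_even (n : ℕ) : ∑ b ∈ Icc 1 (2 * n), chi4 b ^ 2 = n := by
  induction n with
  | zero => simp
  | succ n ih =>
    rw [show 2 * (n + 1) = 2 * n + 1 + 1 by ring, Finset.sum_Icc_succ_top (by omega),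
      Finset.sum_Icc_succ_top (by omega), ih, chi4_sq, chi4_sq]
    have h1 : (2 * n + 1) % 2 = 1 := by omega
    have h2 : (2 * n + 1 + 1) % 2 = 0 := by omega
    simp [h1, h2]

/-- `(2n, 4n]` contains `n` odd numbers. -/
theorem sum_chi4_sq_rows (n : ℕ) : ∑ a ∈ Ioc (2 * n) (4 * n), chi4 a ^ 2 = n := by
  have h1 := sum_chi4_sq_Icc_even n
  have h2 := sum_chi4_sq_Icc_even (2 * n)
  rw [show 2 * (2 * n) = 4 * n by ring] at h2
  have hI : ∀ N : ℕ, (Icc 1 N : Finset ℕ) = Ioc 0 N := fun N => by ext k; simp; omega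
  rw [hI] at h1 h2
  have hsplit := Finset.sum_Ioc_consecutive (fun a => chi4 a ^ 2) (Nat.zero_le (2 * n))
    (by omega : 2 * n ≤ 4 * n)
  rw [h1, h2] at hsplit
  push_cast at hsplit
  linarith

/-- PRETENDER `χ₄`: completely multiplicative, `±1` on odd integers, MEAN ZERO and perfectly
distributed in every progression of odd modulus — yet `TableChowlaFor χ₄` is FALSE: at the shift
`c = 4` its table is rank one (`chi4_mul_add_four`), and at `x = (2n)¹²`, `A = 2n` the moment is
`n² · (B/2)² = x²/16` against the claimed `x²/(12 log 2n)`. (For shifts `4 ∤ c` the χ₄-table is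
4-periodic in `a` and in `b`, hence of rank ≤ 4 with `‖M‖_F² ≍ AB`, so `T ≥ ‖M‖_F⁴/4 ≫ x²` still —
not formalised.) Moral for provers: the decisive input is `λ`'s non-pretentiousness to real
characters of conductor dividing the shift, uniformly in the Siegel range — exactly where
`DilatedTableChowla`'s ℓ¹-average over dilations is designed to pay only `x² log x / q₁`. -/
theorem not_tableChowlaFor_chi4 : ¬ TableChowlaFor chi4 := by
  intro h
  obtain ⟨x₀, hx₀⟩ := h 4 (by norm_num) (1 / 12) (by norm_num) le_rfl 1 one_pos
  obtain ⟨n, hn⟩ := exists_nat_ge (max x₀ 2)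
  have hn2 : (2 : ℝ) ≤ n := le_trans (le_max_right _ _) hn
  have hnx : x₀ ≤ n := le_trans (le_max_left _ _) hn
  have hm4 : (4 : ℝ) ≤ ((2 * n : ℕ) : ℝ) := by push_cast; linarith
  have hm1 : (1 : ℝ) ≤ ((2 * n : ℕ) : ℝ) := by linarith
  have hm1' : 1 ≤ 2 * n := by exact_mod_cast hm1
  have hm0 : 2 * n ≠ 0 := by omega
  have hmpos : (0 : ℝ) < ((2 * n : ℕ) : ℝ) := by linarith
  have hxx₀ : x₀ ≤ (((2 * n : ℕ) : ℝ)) ^ 12 :=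
    (hnx.trans (by push_cast; linarith)).trans (le_self_pow₀ hm1 (by norm_num))
  obtain ⟨hw1, hw2⟩ := window_pow (k := 12) (by norm_num) hm1'
  have key := hx₀ ((((2 * n : ℕ) : ℝ)) ^ 12) hxx₀ (2 * n : ℕ) (by exact_mod_cast hw1)
    (by exact_mod_cast hw2)
  rw [moment_pow chi4 4 (by norm_num) hm0, momentN_of_rankOne (f := chi4) (c := 4) chi4 chi4 ?_,
    Real.rpow_one, Real.log_pow] at key
  swap
  · intro a _ b _
    rw [show ((a : ℤ) * (b : ℕ) + 4) = ((a * b + 4 : ℕ) : ℤ) by push_cast; ring, Int.toNat_natCast,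
      chi4_mul_add_four]
  have hrows : ∑ a ∈ Ioc (2 * n) (2 * (2 * n)), chi4 a ^ 2 = n := by
    rw [show 2 * (2 * n) = 4 * n by ring]; exact sum_chi4_sq_rows n
  have hcols : ∑ b ∈ Icc 1 ((2 * n) ^ (12 - 1)), chi4 b ^ 2 = ((2 ^ 10 * n ^ 11 : ℕ) : ℝ) := by
    rw [show (2 * n) ^ (12 - 1) = 2 * (2 ^ 10 * n ^ 11) by ring]; exact sum_chi4_sq_Icc_even _
  rw [hrows, hcols] at key
  push_cast at key
  -- key : n² ² · (2¹⁰ n¹¹)² ≤ ((2n)¹²)² / (12 log (2n)) ; note ((2n)¹²)² = 16 · LHS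
  have hP : (0 : ℝ) < (n : ℝ) ^ 2 * ((1024 : ℝ) * (n : ℝ) ^ 11) ^ 2 := by
    have : (0 : ℝ) < n := by linarith
    positivity
  refine absurd_of_le_div hP (κ := 16) ?_ (by norm_num) ?_ key
  · exact le_of_eq (by ring)
  have hlog4 : Real.log 4 ≤ Real.log ((2 * n : ℕ) : ℝ) := Real.log_le_log (by norm_num) hm4
  have : Real.log 4 = 2 * Real.log 2 := by
    rw [show (4 : ℝ) = 2 ^ 2 by norm_num, Real.log_pow]; push_cast; ring
  have := Real.log_two_gt_d9
  push_cast at hlog4 ⊢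
  linarith

end

end Summit.Parity.GeneralizedHardyLittlewood.Theorems.TableChowla.Negative
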